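import Literature.Geometry.Lorentzian.GeodesicProofs
import Literature.Geometry.Lorentzian.LeviCivitaProofs
import HarnessLib

/-!
# Geodesics have constant speed (discharge of `val_velocity_eq_of_isGeodesicOn`)

This file discharges the named fact
`Literature.Geometry.Lorentzian.PseudoRiemannianMetric.val_velocity_eq_of_isGeodesicOn` of
`Literature.Geometry.Lorentzian.Geodesic`: along a geodesic `γ` of the Levi-Civita connection of a
`C^n` pseudo-Riemannian metric `g` (`n ≥ 1`) on an open interval `s`, the quantity
`g_{γ t}(γ' t, γ' t)` is constant (O'Neill, *Semi-Riemannian geometry* (1983), Ch. 3, p. 69,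
remark after Def. 23 — "if `γ` is a geodesic, `⟨γ', γ'⟩` is constant since
`(d/ds)⟨γ', γ'⟩ = 2⟨γ'', γ'⟩ = 0`" — and Ch. 5, p. 131).

## The printed proof and its formalisation

The one-line printed proof rests on the **product rule for the induced covariant derivative**,
O'Neill 1983, Ch. 3, Prop. 18, p. 65: for vector fields `V, W` along a curve `γ`,
`(d/dt) g(V, W) = g(V', W) + g(V, W')` (proof, p. 66: write `V = ∑ Vⁱ ∂ᵢ`, `W = ∑ Wʲ ∂ⱼ` in a
chart, so that `g(V, W) = ∑ Vⁱ Wʲ gᵢⱼ(γ)`, differentiate, and use the coordinate formula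
`V' = ∑ (Vⁱ)' ∂ᵢ + ∑ Vⁱ D_{γ'} ∂ᵢ` together with metric compatibility
`γ' gᵢⱼ = g(D_{γ'} ∂ᵢ, ∂ⱼ) + g(∂ᵢ, D_{γ'} ∂ⱼ)`). This is proved here for an arbitrary
`g`-compatible covariant derivative `cov` (`PseudoRiemannianMetric.hasDerivAt_val_apply_along`):
the frame is the canonical local frame `sᵢ` at `γ t₀` in which `covariantDerivAlong` is *defined*
(`Geodesic.lean`), the coefficient functions of `V`, `W` are differentiable at `t₀` because the
lifts `t ↦ (γ t, V t)`, `t ↦ (γ t, W t)` are (`differentiableAt_trivialization_lift`), the metric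
coefficients `gᵢⱼ = g(sᵢ, sⱼ)` are differentiable (`mdifferentiableAt_val_apply`) with derivative
along `γ' t₀` given by compatibility applied to the canonical extension `FiberBundle.extend` of
`γ' t₀`, and the rest is the printed algebra. For a geodesic (`V = W = γ'`, `D(γ')/dt = 0`) the
derivative of `g(γ', γ')` vanishes on `s`, so the function is constant on the open interval `s`
(`IsOpen.is_const_of_fderiv_eq_zero`). The Levi-Civita connection of `LeviCivita.lean` is
`g`-compatible by the proved fundamental lemma (`isLeviCivita_leviCivita_holds`,
`LeviCivitaProofs.lean`), whence the named fact (`val_velocity_eq_of_isGeodesicOn_holds`).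

## References

* B. O'Neill, *Semi-Riemannian geometry with applications to relativity*, Academic Press 1983,
  Ch. 3: Prop. 18 (pp. 65–66, induced covariant derivative, product rule (3) and its coordinate
  proof), Def. 23 and the remark following it (p. 69, `⟨γ', γ'⟩` is constant along a geodesic);
  Ch. 5, p. 131.
-/

noncomputable section

open Bundle Set Filter
open scoped Manifold ContDiff Topology

namespace Literature.Geometry.Lorentzian

variable {E : Type*} [NormedAddCommGroup E] [NormedSpace ℝ E] {H : Type*} [TopologicalSpace H]
  {I : ModelWithCorners ℝ E H} {M : Type*} [TopologicalSpace M] [ChartedSpace H M]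
  [IsManifold I ∞ M] [FiniteDimensional ℝ E] {n : ℕ∞ω}

namespace PseudoRiemannianMetric

variable (g : PseudoRiemannianMetric I n E (TangentSpace I : M → Type _))

omit [FiniteDimensional ℝ E] in
/-- Bilinear expansion of the metric on two finite linear combinations:
`g_x(∑ aᵢ uᵢ, ∑ bⱼ wⱼ) = ∑ᵢ ∑ⱼ aᵢ bⱼ g_x(uᵢ, wⱼ)`. [folklore] -/
theorem val_sum_smul_sum_smul {ι : Type*} [Fintype ι] (x : M) (a c : ι → ℝ)
    (u w : ι → TangentSpace I x) :
    g.val x (∑ i, a i • u i) (∑ j, c j • w j) = ∑ i, ∑ j, a i * c j * g.val x (u i) (w j) := by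
  have h1 : g.val x (∑ i, a i • u i) = ∑ i, a i • g.val x (u i) := by
    rw [map_sum]
    exact Finset.sum_congr rfl fun i _ ↦ map_smul _ _ _
  rw [h1, sum_apply]
  refine Finset.sum_congr rfl fun i _ ↦ ?_
  rw [smul_apply, map_sum, smul_eq_mul, Finset.mul_sum]
  refine Finset.sum_congr rfl fun j _ ↦ ?_
  rw [map_smul, smul_eq_mul]
  ring

/-- **Product rule for the covariant derivative along a curve** (O'Neill 1983, Ch. 3, Prop. 18
(3), p. 65: `(d/dt)⟨V, W⟩ = ⟨V', W⟩ + ⟨V, W'⟩` for vector fields `V, W` along `γ`; proof p. 66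
in coordinates). For a covariant derivative `cov` on `TM` compatible with the `C^n` metric `g`
(`g.IsCompatible cov`, `n ≥ 1`), a curve `γ` and vector fields `V, W` along `γ` whose lifts
`t ↦ (γ t, V t)`, `t ↦ (γ t, W t)` to `TM` are differentiable at `t₀`, the scalar function
`t ↦ g_{γ t}(V t, W t)` has derivative `g(DV/dt, W) + g(V, DW/dt)` at `t₀`, with
`DV/dt = covariantDerivAlong cov γ V t₀` the local-frame formula of `Geodesic.lean`. Proof as
printed: in the canonical frame `sᵢ` at `γ t₀`, `g(V, W) = ∑ Vⁱ Wʲ gᵢⱼ(γ)` near `t₀`; the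
coefficient functions are differentiable at `t₀`, the `gᵢⱼ = g(sᵢ, sⱼ)` are differentiable at
`γ t₀` with `γ'(t₀) gᵢⱼ = g(∇_{γ'} sᵢ, sⱼ) + g(sᵢ, ∇_{γ'} sⱼ)` (compatibility, applied to the
canonical extension of `γ' t₀` to a vector field), and the Leibniz rule gives the claim.
[cite: ONeill1983, Ch. 3, Prop. 18 (3)] -/
theorem hasDerivAt_val_apply_along [Fact (1 ≤ n)]
    {cov : CovariantDerivative I E (TangentSpace I : M → Type _)} (hcov : g.IsCompatible cov)
    {γ : ℝ → M} {V W : Π t : ℝ, TangentSpace I (γ t)} {t₀ : ℝ}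
    (hV : MDifferentiableAt 𝓘(ℝ, ℝ) I.tangent
      (fun t ↦ (TotalSpace.mk' E (γ t) (V t) : TangentBundle I M)) t₀)
    (hW : MDifferentiableAt 𝓘(ℝ, ℝ) I.tangent
      (fun t ↦ (TotalSpace.mk' E (γ t) (W t) : TangentBundle I M)) t₀) :
    HasDerivAt (fun t ↦ g.val (γ t) (V t) (W t))
      (g.val (γ t₀) (covariantDerivAlong cov γ V t₀) (W t₀) +
        g.val (γ t₀) (V t₀) (covariantDerivAlong cov γ W t₀)) t₀ := by
  set e := trivializationAt E (TangentSpace I : M → Type _) (γ t₀) with he_def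
  set b := Module.finBasis ℝ E with hb_def
  set s : Fin (Module.finrank ℝ E) → Π y : M, TangentSpace I y := e.localFrame b with hs_def
  set c : Fin (Module.finrank ℝ E) → ℝ → ℝ := fun i t ↦ e.localFrame_coeff I b i (γ t) (V t)
    with hc_def
  set d : Fin (Module.finrank ℝ E) → ℝ → ℝ := fun j t ↦ e.localFrame_coeff I b j (γ t) (W t)
    with hd_def
  set v₀ : TangentSpace I (γ t₀) := velocity I γ t₀ with hv₀_def
  have he : γ t₀ ∈ e.baseSet := FiberBundle.mem_baseSet_trivializationAt' (γ t₀)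
  have hγ : MDifferentiableAt 𝓘(ℝ, ℝ) I γ t₀ := mdifferentiableAt_of_mdifferentiableAt_lift hV
  have hγe : ∀ᶠ t in 𝓝 t₀, γ t ∈ e.baseSet :=
    hγ.continuousAt.preimage_mem_nhds (e.open_baseSet.mem_nhds he)
  -- the frame is differentiable at `γ t₀`
  have hs : ∀ i, MDiffAt (T% (s i)) (γ t₀) := fun i ↦
    (contMDiffAt_localFrame_of_mem 1 e b i he).mdifferentiableAt one_ne_zero
  -- expansions of `V` and `W` in the frame
  have hVexp : ∀ t, γ t ∈ e.baseSet → V t = ∑ i, c i t • s i (γ t) := fun t ht ↦ by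
    simpa only using e.eq_sum_localFrame_coeff_smul (I := I) (b := b) (s := fun _ ↦ V t) ht
  have hWexp : ∀ t, γ t ∈ e.baseSet → W t = ∑ j, d j t • s j (γ t) := fun t ht ↦ by
    simpa only using e.eq_sum_localFrame_coeff_smul (I := I) (b := b) (s := fun _ ↦ W t) ht
  -- the coefficient functions are differentiable at `t₀`
  have hcoef : ∀ {U : Π t : ℝ, TangentSpace I (γ t)},
      MDifferentiableAt 𝓘(ℝ, ℝ) I.tangent
        (fun t ↦ (TotalSpace.mk' E (γ t) (U t) : TangentBundle I M)) t₀ →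
      ∀ i, DifferentiableAt ℝ (fun t ↦ e.localFrame_coeff I b i (γ t) (U t)) t₀ := by
    intro U hU i
    have h1 := differentiableAt_trivialization_lift e hU he
    have h2 : DifferentiableAt ℝ
        (fun t ↦ b.coord i ((e (TotalSpace.mk' E (γ t) (U t))).2)) t₀ :=
      (LinearMap.toContinuousLinearMap (b.coord i)).differentiableAt.comp t₀ h1
    refine h2.congr_of_eventuallyEq ?_
    filter_upwards [hγe] with t ht
    rw [e.localFrame_coeff_eq_coeff (I := I) (b := b) (s := fun _ ↦ U t) ht]
    simp
  have hc : ∀ i, DifferentiableAt ℝ (c i) t₀ := hcoef hV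
  have hd : ∀ j, DifferentiableAt ℝ (d j) t₀ := hcoef hW
  -- the metric coefficients and their derivative along `γ' t₀` (compatibility)
  set G : Fin (Module.finrank ℝ E) → Fin (Module.finrank ℝ E) → M → ℝ :=
    fun i j y ↦ g.val y (s i y) (s j y) with hG_def
  have hGγ : ∀ i j, HasDerivAt (fun t ↦ G i j (γ t))
      (g.val (γ t₀) (cov (s i) (γ t₀) v₀) (s j (γ t₀)) +
        g.val (γ t₀) (s i (γ t₀)) (cov (s j) (γ t₀) v₀)) t₀ := by
    intro i j
    have h1 := hasDerivAt_comp_curve (g.mdifferentiableAt_val_apply (hs i) (hs j)) hγ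
    refine h1.congr_deriv ?_
    have hX : MDiffAt (T% (FiberBundle.extend E v₀)) (γ t₀) :=
      FiberBundle.mdifferentiableAt_extend ..
    have h2 := hcov hX (hs i) (hs j)
    rw [FiberBundle.extend_apply_self] at h2
    exact h2
  -- `g(V, W) = ∑ Vⁱ Wʲ gᵢⱼ(γ)` near `t₀`, and its derivative
  have hfexp : (fun t ↦ g.val (γ t) (V t) (W t)) =ᶠ[𝓝 t₀]
      fun t ↦ ∑ i, ∑ j, c i t * d j t * G i j (γ t) := by
    filter_upwards [hγe] with t ht
    rw [hVexp t ht, hWexp t ht, g.val_sum_smul_sum_smul]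
  have hD : HasDerivAt (fun t ↦ ∑ i, ∑ j, c i t * d j t * G i j (γ t))
      (∑ i, ∑ j, ((deriv (c i) t₀ * d j t₀ + c i t₀ * deriv (d j) t₀) * G i j (γ t₀) +
        c i t₀ * d j t₀ * (g.val (γ t₀) (cov (s i) (γ t₀) v₀) (s j (γ t₀)) +
          g.val (γ t₀) (s i (γ t₀)) (cov (s j) (γ t₀) v₀)))) t₀ :=
    HasDerivAt.fun_sum fun i _ ↦ HasDerivAt.fun_sum fun j _ ↦
      ((hc i).hasDerivAt.mul (hd j).hasDerivAt).mul (hGγ i j)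
  refine (hD.congr_of_eventuallyEq hfexp).congr_deriv ?_
  -- the algebra: compare with `g(DV/dt, W) + g(V, DW/dt)` expanded in the frame
  have hDV : covariantDerivAlong cov γ V t₀ =
      ∑ i, deriv (c i) t₀ • s i (γ t₀) + ∑ i, c i t₀ • cov (s i) (γ t₀) v₀ := rfl
  have hDW : covariantDerivAlong cov γ W t₀ =
      ∑ j, deriv (d j) t₀ • s j (γ t₀) + ∑ j, d j t₀ • cov (s j) (γ t₀) v₀ := rfl
  rw [hDV, hDW, hWexp t₀ he, hVexp t₀ he, map_add (g.val (γ t₀)), add_apply,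
    map_add (g.val (γ t₀) (∑ i, c i t₀ • s i (γ t₀))), g.val_sum_smul_sum_smul,
    g.val_sum_smul_sum_smul, g.val_sum_smul_sum_smul, g.val_sum_smul_sum_smul,
    ← Finset.sum_add_distrib, ← Finset.sum_add_distrib, ← Finset.sum_add_distrib]
  refine Finset.sum_congr rfl fun i _ ↦ ?_
  rw [← Finset.sum_add_distrib, ← Finset.sum_add_distrib, ← Finset.sum_add_distrib]
  refine Finset.sum_congr rfl fun j _ ↦ ?_
  simp only [hG_def]
  ring

/-- **Along a geodesic of a compatible connection, `g(γ', γ')` has zero derivative** (O'Neill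
1983, Ch. 3, p. 69: `(d/ds)⟨γ', γ'⟩ = 2⟨γ'', γ'⟩ = 0`). For `cov` compatible with `g` and `γ`
a geodesic of `cov` on `s`, at every `t ∈ s` the function `t ↦ g_{γ t}(γ' t, γ' t)` has
derivative `0` (product rule `hasDerivAt_val_apply_along` with `V = W = γ'` and
`D(γ')/dt = 0`). [cite: ONeill1983, Ch. 3, p. 69] -/
theorem hasDerivAt_val_velocity_of_isGeodesicOn [Fact (1 ≤ n)]
    {cov : CovariantDerivative I E (TangentSpace I : M → Type _)} (hcov : g.IsCompatible cov)
    {γ : ℝ → M} {s : Set ℝ} (hγ : IsGeodesicOn cov γ s) {t : ℝ} (ht : t ∈ s) :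
    HasDerivAt (fun t ↦ g.val (γ t) (velocity I γ t) (velocity I γ t)) 0 t := by
  have h := g.hasDerivAt_val_apply_along hcov (V := fun t ↦ velocity I γ t)
    (W := fun t ↦ velocity I γ t) (hγ.1 t ht) (hγ.1 t ht)
  rw [hγ.2 t ht] at h
  simpa using h

/-- **Geodesics of a compatible connection have constant speed** (O'Neill 1983, Ch. 3, p. 69,
remark after Def. 23). For `cov` compatible with the `C^n` metric `g` (`n ≥ 1`) and a geodesic
`γ` of `cov` on an open interval `s`, `g_{γ t}(γ' t, γ' t)` takes the same value at any two
parameters of `s`: its derivative vanishes on `s` (`hasDerivAt_val_velocity_of_isGeodesicOn`),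
and a function with zero derivative on an open interval is constant there
(`IsOpen.is_const_of_fderiv_eq_zero`). [cite: ONeill1983, Ch. 3, p. 69] -/
theorem val_velocity_eq_of_isGeodesicOn_of_isCompatible [Fact (1 ≤ n)]
    {cov : CovariantDerivative I E (TangentSpace I : M → Type _)} (hcov : g.IsCompatible cov)
    {γ : ℝ → M} {s : Set ℝ} (hs : IsOpen s) (hsc : s.OrdConnected) (hγ : IsGeodesicOn cov γ s)
    {t₁ t₂ : ℝ} (ht₁ : t₁ ∈ s) (ht₂ : t₂ ∈ s) :
    g.val (γ t₁) (velocity I γ t₁) (velocity I γ t₁) =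
      g.val (γ t₂) (velocity I γ t₂) (velocity I γ t₂) := by
  have hd : ∀ t ∈ s, HasDerivAt (fun t ↦ g.val (γ t) (velocity I γ t) (velocity I γ t)) 0 t :=
    fun t ht ↦ g.hasDerivAt_val_velocity_of_isGeodesicOn hcov hγ ht
  refine hs.is_const_of_fderiv_eq_zero (𝕜 := ℝ) hsc.isPreconnected
    (fun t ht ↦ (hd t ht).differentiableAt.differentiableWithinAt) (fun t ht ↦ ?_) ht₁ ht₂
  have h := (hd t ht).hasFDerivAt.fderiv
  rw [h]
  ext
  simp

/-- **Geodesics have constant speed** (discharge of the named fact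
`val_velocity_eq_of_isGeodesicOn`; O'Neill 1983, Ch. 3, p. 69, remark after Def. 23: "if `γ`
is a geodesic, `⟨γ', γ'⟩` is constant", and Ch. 5, p. 131). Along a geodesic of the Levi-Civita
connection of `g` on an open interval, `g(γ', γ')` is constant: the Levi-Civita connection is
compatible with `g` (fundamental lemma, `isLeviCivita_leviCivita_holds`), so
`val_velocity_eq_of_isGeodesicOn_of_isCompatible` applies. [cite: ONeill1983, Ch. 3, p. 69] -/
theorem val_velocity_eq_of_isGeodesicOn_holds [CompleteSpace E] [Fact (1 ≤ n)]
    [g.HasLeviCivita] : g.val_velocity_eq_of_isGeodesicOn := by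
  intro γ s hs hsc hγ t₁ t₂ ht₁ ht₂
  exact g.val_velocity_eq_of_isGeodesicOn_of_isCompatible (isLeviCivita_leviCivita_holds (g := g)).2
    hs hsc hγ ht₁ ht₂

end PseudoRiemannianMetric

end Literature.Geometry.Lorentzian

end
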